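import Summits.Ventures.HodgeRepro2.T6A2Main
import Summits.Ventures.HodgeRepro2.T6A3Main

/-!
# T6A3A2Inputs — A2's M1 handle (`A2_inputs`) in the composition contract's vocabulary, filed by t6-p3 under
lead reassignment

Cell pub-hodge-repro2, Tier 6 (README §10). PROOF BY t6-p2 (g0): `eK_mem_eigenLineK` and `A2_inputs_sum`
below are t6-p2's, verbatim from its read copy route/t6-p2-lean/T6A2Inputs.lean (14:25Z; at this filing
not yet proposed — the seat was parked from STATUS l. 4592; t6-p2's own T6A2Inputs was then filed and
ACCEPTED as p401805, RECORD ONLY — FQN-distinct, no twin, nothing references it; route/T6-A2-t6p2.md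
row 15); FILED BY t6-p3 (A3 owner) under lead reassignment, STATUS
l. 4994 (3) («if no t6-p2 line by ≈15:55Z, t6-p3 takes the A2 handle»), in the A3 prefix and the namespace
`T6.A3A2Inputs` so that no twin arises if t6-p2's own file lands later (it did, FQN-distinct: p401805).
ADDED by t6-p3: `A2_inputs`, the
handle in `A3_main`'s vocabulary (`extC K θ = modelEquiv E (theta c)`, `c : Pl → ℂ`), obtained from the sum
form by t6-p3's dictionary `A3Main.theta_eq_of_eigenBasis` (T6A3Main, p400620) — the `hθ` binder of
`A3_main` (M1 composition contract, STATUS l. 4494 / l. 4587).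

t6-p2's description (verbatim): re-indexes `A2Main.exists_theta` (embeddings through `Gal(K/ℚ)` and a base
embedding) to an `A3Model.EigenBasis E` (embeddings through `E.emb : Fin 3 × Bool ≃ (K →+* ℂ)`): with
`τ₁ := E.emb (0, false)`, `exists_emb_eq` writes every `E.emb (ν, false)` as `τ₁ ∘ g_ν`, and the
conjugate-pairing hypothesis `E.emb (ν, true) = conjugate (E.emb (ν, false))` (`hconj`, the one fact the
contract's `E` must carry for θ to be of type (1,1)) identifies `E.emb (ν, true)` with `τ₁ ∘ (cc ∘ g_ν)`
(`conjugate_emb`). The generator binders come from `heB` / `hne` / `hspan`. No `sorry`; standard axioms.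

v2 = a DOCSTRING-ONLY successor version (kernel content unchanged; count NONE; filed under the PARK
release clause STATUS l. 12943 in the lead's CLASS reading l. 13037 (1) — the in-body stale-tag class
of t6-p6's l. 13057; v1 p401750 = the M1 bytes of record, scored WAVE 7 row T6-R1-5x): the clause
«never proposed — the seat has been parked since STATUS l. 4592» about t6-p2's read copy is replaced by
the record (t6-p2 filed T6A2Inputs as p401805, ACCEPTED at M1, record-only); nothing else changes.

§8(d): uses an L-value-free non-vanishing device: NO.
-/

namespace Summit.Ventures.HodgeRepro2.T6.A3A2Inputs

open Summit.Ventures.HodgeRepro2.T6 Summit.Ventures.HodgeRepro2.T6.A2Conj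
  Summit.Ventures.HodgeRepro2.T6.A2Theta Summit.Ventures.HodgeRepro2.T6.A2Main
  Summit.Ventures.HodgeRepro2.T6.A3Model NumberField

variable {K : Type*} [Field K] [NumberField K] [IsCMField K] [IsGalois ℚ K]

omit [IsCMField K] [IsGalois ℚ K] in
/-- The eigenvector `eK σ` of the eigenbasis lies on the `σ`-eigenline of `K ⊗ ℂ`
(from `E.eigen`: `ℓ_{i,σ} = ℂ · eB (i, σ)` and `eB (i, σ) = single i (eK σ)`). [proof by t6-p2 (g0), read
copy of 14:25Z; filed by t6-p3 under lead reassignment STATUS l. 4994 (3) while t6-p2 is parked] -/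
theorem eK_mem_eigenLineK (E : EigenBasis K) (eK : (K →+* ℂ) → KC K)
    (heB : ∀ (i : Fin 4) (σ : K →+* ℂ), E.eB (i, σ) = LinearMap.single ℂ (fun _ => KC K) i (eK σ))
    (σ : K →+* ℂ) : eK σ ∈ eigenLineK K σ := by
  have h : LinearMap.single ℂ (fun _ => KC K) (0 : Fin 4) (eK σ) ∈ eigenLine K 0 σ := by
    rw [E.eigen 0 σ, heB]
    exact Submodule.mem_span_singleton_self _
  obtain ⟨w, hw, hw'⟩ := Submodule.mem_map.mp h
  have : w = eK σ := by
    have := congrArg (fun f => f (0 : Fin 4)) hw'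
    simpa using this
  rw [← this]; exact hw

/-- A2's M1 HANDLE, sum form (STATUS l. 4494, A2_inputs): for an eigenbasis `E` whose embedding coordinates are
conjugate-paired and whose vectors are `single i (eK σ)` with `eK σ ≠ 0` spanning `K ⊗ ℂ`, there is
`θ ∈ D.Alg 1` with `extC θ = Σ_{i,ν} c_{i,ν} ι(single i (eK (E.emb (ν,false)))) ∧ ι(single i (eK (E.emb (ν,true))))`
and every `c_{i,ν} ≠ 0` (TIER4 (S2)). [proof by t6-p2 (g0), read copy of 14:25Z; filed by t6-p3 under lead
reassignment STATUS l. 4994 (3) while t6-p2 is parked] -/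
theorem A2_inputs_sum {F : FaceSetting K} (D : TransferShadow F) (E : EigenBasis K)
    (hconj : ∀ ν : Fin 3, E.emb (ν, true) = ComplexEmbedding.conjugate (E.emb (ν, false)))
    (eK : (K →+* ℂ) → KC K)
    (heB : ∀ (i : Fin 4) (σ : K →+* ℂ), E.eB (i, σ) = LinearMap.single ℂ (fun _ => KC K) i (eK σ))
    (hne : ∀ σ, eK σ ≠ 0) (hspan : Submodule.span ℂ (Set.range eK) = ⊤) :
    ∃ θ ∈ D.Alg 1, ∃ c : Fin 4 → Fin 3 → ℂ, (∀ i ν, c i ν ≠ 0) ∧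
      extC K θ = ∑ i : Fin 4, ∑ ν : Fin 3, c i ν •
        (ExteriorAlgebra.ι ℂ (LinearMap.single ℂ (fun _ => KC K) i (eK (E.emb (ν, false)))) *
          ExteriorAlgebra.ι ℂ (LinearMap.single ℂ (fun _ => KC K) i (eK (E.emb (ν, true))))) := by
  classical
  set τ₁ : K →+* ℂ := E.emb (0, false) with hτ₁
  -- the half-system through Gal(K/ℚ)
  choose τ hτ using fun ν : Fin 3 => exists_emb_eq K τ₁ (E.emb (ν, false))
  have hτbar : ∀ ν, emb K τ₁ ((cc K).trans (τ ν)) = E.emb (ν, true) := by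
    intro ν
    rw [hconj, ← conjugate_emb, ← hτ ν]
  -- the generators indexed by Gal(K/ℚ)
  let e : (K ≃ₐ[ℚ] K) → KC K := fun g => eK (emb K τ₁ g)
  have he : ∀ g, e g ∈ eigenLineK K (emb K τ₁ g) := fun g => eK_mem_eigenLineK E eK heB _
  have hne' : ∀ g, e g ≠ 0 := fun g => hne _
  have hspan' : Submodule.span ℂ (Set.range e) = ⊤ := by
    rw [← hspan]
    congr 1
    ext v
    constructor
    · rintro ⟨g, rfl⟩; exact ⟨_, rfl⟩
    · rintro ⟨σ, rfl⟩
      obtain ⟨g, rfl⟩ := exists_emb_eq K τ₁ σ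
      exact ⟨g, rfl⟩
  have hτcov : ∀ g, ∃ ν, g = τ ν ∨ g = (cc K).trans (τ ν) := by
    intro g
    obtain ⟨⟨ν, s⟩, hs⟩ := E.emb.surjective (emb K τ₁ g)
    refine ⟨ν, ?_⟩
    cases s
    · left
      apply emb_injective K τ₁
      rw [← hτ ν, hs]
    · right
      apply emb_injective K τ₁
      rw [hτbar ν, hs]
  have hτdist : ∀ ν ν', τ ν' = τ ν ∨ τ ν' = (cc K).trans (τ ν) → ν' = ν := by
    intro ν ν' h
    rcases h with h | h
    · have := hτ ν'
      rw [h, ← hτ ν] at this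
      have h2 : (ν', false) = (ν, false) := E.emb.injective this
      exact (Prod.mk.inj h2).1
    · have := hτ ν'
      rw [h, hτbar ν] at this
      have h2 : (ν', false) = (ν, true) := E.emb.injective this
      exact absurd (Prod.mk.inj h2).2 Bool.noConfusion
  obtain ⟨θ, hθ, -, c, hc, hext⟩ := exists_theta K τ₁ F D e he hne' hspan' τ hτcov hτdist
  refine ⟨θ, hθ, c, hc, ?_⟩
  rw [hext]
  refine Finset.sum_congr rfl fun i _ => Finset.sum_congr rfl fun ν _ => ?_
  simp only [planeGen, gen1C, e, hτ ν, hτbar ν]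

/-- A2's M1 HANDLE in `A3_main`'s vocabulary (the contract's `A2_inputs`, STATUS l. 4494 / l. 4587; EXACTLY the
binder `hA2` of the lead's `T6TheoremA.theoremA_of_N_of_A2`, STATUS l. 5008 (1), as `A2_inputs D`): the sum
form `A2_inputs_sum` read through t6-p3's dictionary `A3Main.theta_eq_of_eigenBasis` with `a ν := eK (E.emb
(ν, false))`, `b ν := eK (E.emb (ν, true))` and `c' p := c p.1 p.2`. -/
theorem A2_inputs {F : FaceSetting K} (D : TransferShadow F) (E : EigenBasis K)
    (hconj : ∀ ν : Fin 3, E.emb (ν, true) = ComplexEmbedding.conjugate (E.emb (ν, false)))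
    (eK : (K →+* ℂ) → KC K)
    (heB : ∀ (i : Fin 4) (σ : K →+* ℂ), E.eB (i, σ) = LinearMap.single ℂ (fun _ => KC K) i (eK σ))
    (hne : ∀ σ, eK σ ≠ 0) (hspan : Submodule.span ℂ (Set.range eK) = ⊤) :
    ∃ θ ∈ D.Alg 1, ∃ c : Pl → ℂ, (∀ p, c p ≠ 0) ∧
      extC K θ = modelEquiv E (WeilPlanes.theta c) := by
  obtain ⟨θ, hθ, c, hc, hext⟩ := A2_inputs_sum D E hconj eK heB hne hspan
  exact ⟨θ, hθ, fun p => c p.1 p.2, fun p => hc p.1 p.2,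
    hext.trans (A3Main.theta_eq_of_eigenBasis E (fun ν => eK (E.emb (ν, false)))
      (fun ν => eK (E.emb (ν, true))) (fun i _ => heB i _) (fun i _ => heB i _) c)⟩

end Summit.Ventures.HodgeRepro2.T6.A3A2Inputs
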